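import Summits.QuantumAdvantage.QuantumAdvantage.Theorems.WalkTwoStepFarLocalFlip
import Summits.QuantumAdvantage.QuantumAdvantage.Theorems.WalkTwoStepSparsePinnedPart

/-!
# (G♯) local engine — toward `FarLocal p`, part 2: BLOCK CALCULUS for inputs with two marked corners

Cell qa-qnc0, rung (G♯) = item stmt-QuantumAdvantage-23121 (planner qa-qnc0-p2 g24, ask P2-24b); prover qn-prover-3 g15.

The counting behind `FarLocal` writes an input as FIVE glued blocks `uX ++ κ ++ (uY ++ κ' ++ uZ)` (`CleanGapStrategies.glue3` twice, the
two-bit blocks `κ, κ' : Fin 2 → Bool` sitting at the two corner positions `g` and `s_g`).  This file provides the bookkeeping: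
* corner flips act inside one block of an appended input (`cornerFlip_append_left`, `cornerFlip_append_right`), hence on a glued input
  they swap the two bits of the relevant two-bit block (`cornerFlip_glue3_mid`, `cornerFlip_glue3_right`);
* weights and prefix weights of two-bit blocks and of glued inputs at the block boundaries (`wt_two`, `wtPrefix_two_one`,
  `wtPrefix_of_length_le`, `wtPrefix_glue3_mid`);
* Fubini over the three blocks as a SUM identity (`sum_glue3`; the landed `card_filter_eq_sum_glue3` is the counting special case).
WHAT THIS IS NOT: no statement about strategies; separation NOT moved.
-/

namespace Summit.QuantumAdvantage.AdviceFreeQNC0.LocalEngine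

open Finset Classical

section Blocks

variable {L L' : ℕ}

/-! ### Corner flips inside appended blocks -/

/-- A corner flip inside the FIRST block of an appended input acts on that block. -/
theorem cornerFlip_append_left (u : Fin L → Bool) (v : Fin L' → Bool) {τ : ℕ} (h1 : 1 ≤ τ) (h2 : τ < L) :
    cornerFlip (L + L') τ (Fin.append u v) = Fin.append (cornerFlip L τ u) v := by
  unfold cornerFlip
  rw [dif_pos ⟨h1, by omega⟩, dif_pos ⟨h1, h2⟩]
  funext i
  simp only [Function.comp_apply]
  induction i using Fin.addCases with
  | left j =>
    have hinj : Function.Injective (Fin.castAdd L' : Fin L → Fin (L + L')) := Fin.castAdd_injective _ _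
    have e1 : (⟨τ - 1, by omega⟩ : Fin (L + L')) = Fin.castAdd L' ⟨τ - 1, by omega⟩ := Fin.ext rfl
    have e2 : (⟨τ, by omega⟩ : Fin (L + L')) = Fin.castAdd L' ⟨τ, h2⟩ := Fin.ext rfl
    rw [e1, e2, ← hinj.map_swap, Fin.append_left, Fin.append_left]
    rfl
  | right j =>
    have hne1 : Fin.natAdd L j ≠ (⟨τ - 1, by omega⟩ : Fin (L + L')) := by
      intro h; have := congrArg Fin.val h; simp at this; omega
    have hne2 : Fin.natAdd L j ≠ (⟨τ, by omega⟩ : Fin (L + L')) := by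
      intro h; have := congrArg Fin.val h; simp at this; omega
    rw [Equiv.swap_apply_of_ne_of_ne hne1 hne2, Fin.append_right, Fin.append_right]

/-- A corner flip inside the SECOND block of an appended input acts on that block (at the shifted position). -/
theorem cornerFlip_append_right (u : Fin L → Bool) (v : Fin L' → Bool) {τ : ℕ} (h1 : 1 ≤ τ) (h2 : τ < L') :
    cornerFlip (L + L') (L + τ) (Fin.append u v) = Fin.append u (cornerFlip L' τ v) := by
  unfold cornerFlip
  rw [dif_pos ⟨by omega, by omega⟩, dif_pos ⟨h1, h2⟩]
  funext i
  simp only [Function.comp_apply]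
  induction i using Fin.addCases with
  | left j =>
    have hne1 : Fin.castAdd L' j ≠ (⟨L + τ - 1, by omega⟩ : Fin (L + L')) := by
      intro h; have := congrArg Fin.val h; simp at this; omega
    have hne2 : Fin.castAdd L' j ≠ (⟨L + τ, by omega⟩ : Fin (L + L')) := by
      intro h; have := congrArg Fin.val h; simp at this; omega
    rw [Equiv.swap_apply_of_ne_of_ne hne1 hne2, Fin.append_left, Fin.append_left]
  | right j =>
    have hinj : Function.Injective (Fin.natAdd L : Fin L' → Fin (L + L')) := Fin.natAdd_injective _ _
    have e1 : (⟨L + τ - 1, by omega⟩ : Fin (L + L')) = Fin.natAdd L ⟨τ - 1, by omega⟩ :=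
      Fin.ext (by simp; omega)
    have e2 : (⟨L + τ, by omega⟩ : Fin (L + L')) = Fin.natAdd L ⟨τ, h2⟩ := Fin.ext (by simp)
    rw [e1, e2, ← hinj.map_swap, Fin.append_right, Fin.append_right]
    rfl

variable {a m q : ℕ}

/-- A corner flip inside the MIDDLE block of a glued input. -/
theorem cornerFlip_glue3_mid (uA : Fin a → Bool) (v : Fin m → Bool) (uB : Fin q → Bool) {τ : ℕ} (h1 : 1 ≤ τ) (h2 : τ < m) :
    cornerFlip (a + m + q) (a + τ) (glue3 uA v uB) = glue3 uA (cornerFlip m τ v) uB := by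
  unfold glue3
  rw [cornerFlip_append_left _ _ (by omega) (by omega), cornerFlip_append_right _ _ h1 h2]

/-- A corner flip inside the LAST block of a glued input. -/
theorem cornerFlip_glue3_right (uA : Fin a → Bool) (v : Fin m → Bool) (uB : Fin q → Bool) {τ : ℕ} (h1 : 1 ≤ τ) (h2 : τ < q) :
    cornerFlip (a + m + q) (a + m + τ) (glue3 uA v uB) = glue3 uA v (cornerFlip q τ uB) := by
  unfold glue3
  rw [cornerFlip_append_right _ _ h1 h2]

/-! ### Two-bit blocks -/

/-- The corner flip of a two-bit block swaps its bits: value at `0`. -/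
theorem cornerFlip_two_apply_zero (κ : Fin 2 → Bool) : cornerFlip 2 1 κ 0 = κ 1 := by
  unfold cornerFlip
  rw [dif_pos ⟨le_rfl, by norm_num⟩]
  simp only [Function.comp_apply]
  have e : (Equiv.swap (⟨1 - 1, by omega⟩ : Fin 2) ⟨1, by norm_num⟩) 0 = 1 := by decide
  rw [e]

/-- The corner flip of a two-bit block swaps its bits: value at `1`. -/
theorem cornerFlip_two_apply_one (κ : Fin 2 → Bool) : cornerFlip 2 1 κ 1 = κ 0 := by
  unfold cornerFlip
  rw [dif_pos ⟨le_rfl, by norm_num⟩]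
  simp only [Function.comp_apply]
  have e : (Equiv.swap (⟨1 - 1, by omega⟩ : Fin 2) ⟨1, by norm_num⟩) 1 = 0 := by decide
  rw [e]

/-- Weight of a two-bit block. -/
theorem wt_two (κ : Fin 2 → Bool) : wt κ = (κ 0).toNat + (κ 1).toNat := by
  unfold wt
  rw [Finset.card_filter, Fin.sum_univ_two, toNat_eq_ite, toNat_eq_ite]

/-- Prefix weight of a two-bit block after its first bit. -/
theorem wtPrefix_two_one (κ : Fin 2 → Bool) : wtPrefix κ 1 = (κ 0).toNat := by
  unfold wtPrefix
  rw [Finset.card_filter, Fin.sum_univ_two, toNat_eq_ite]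
  simp

/-- A CORNER: the two bits differ, the first being `b`. -/
def corner (b : Bool) : Fin 2 → Bool := ![b, !b]

/-- Evaluation of a corner block. -/
theorem corner_apply_zero (b : Bool) : corner b 0 = b := rfl

/-- Evaluation of a corner block. -/
theorem corner_apply_one (b : Bool) : corner b 1 = !b := rfl

/-- A corner has weight one. -/
theorem wt_corner (b : Bool) : wt (corner b) = 1 := by
  rw [wt_two, corner_apply_zero, corner_apply_one]; cases b <;> rfl

/-- The corner flip of a corner is the opposite corner. -/
theorem cornerFlip_corner (b : Bool) : cornerFlip 2 1 (corner b) = corner (!b) := by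
  funext i
  match i with
  | ⟨0, _⟩ =>
    have e : (⟨0, by norm_num⟩ : Fin 2) = 0 := rfl
    rw [e, cornerFlip_two_apply_zero, corner_apply_one, corner_apply_zero]
  | ⟨1, _⟩ =>
    have e : (⟨1, by norm_num⟩ : Fin 2) = 1 := rfl
    rw [e, cornerFlip_two_apply_one, corner_apply_zero, corner_apply_one, Bool.not_not]

/-! ### Prefix weights of glued inputs at block boundaries -/

/-- Past the end, the prefix weight is the weight. -/
theorem wtPrefix_of_length_le {n : ℕ} (u : Fin n → Bool) {g : ℕ} (hg : n ≤ g) : wtPrefix u g = wt u := by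
  unfold wtPrefix wt
  congr 1
  ext i
  simp only [Finset.mem_filter, Finset.mem_univ, true_and]
  constructor
  · intro h; exact h.2
  · intro h; exact ⟨by omega, h⟩

/-- Prefix weights inside the middle block of a glued input. -/
theorem wtPrefix_glue3_mid (uA : Fin a → Bool) (v : Fin m → Bool) (uB : Fin q → Bool) {g : ℕ} (h1 : a ≤ g) (h2 : g ≤ a + m) :
    wtPrefix (glue3 uA v uB) g = wt uA + wtPrefix v (g - a) := by
  unfold glue3
  rw [wtPrefix_append_of_le _ _ h2, wtPrefix_append_of_ge _ _ h1]

/-! ### Fubini over the three blocks, as a sum -/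

/-- A sum over `{0,1}^{a+m+q}` is the iterated sum over the three blocks. -/
theorem sum_glue3 {M : Type*} [AddCommMonoid M] (f : (Fin (a + m + q) → Bool) → M) :
    ∑ u : Fin (a + m + q) → Bool, f u
      = ∑ uA : Fin a → Bool, ∑ uB : Fin q → Bool, ∑ v : Fin m → Bool, f (glue3 uA v uB) := by
  rw [← (Fin.appendEquiv (a + m) q).sum_comp, Fintype.sum_prod_type]
  rw [← (Fin.appendEquiv a m).sum_comp, Fintype.sum_prod_type]
  refine Finset.sum_congr rfl fun uA _ => ?_
  rw [Finset.sum_comm]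
  rfl

end Blocks

end Summit.QuantumAdvantage.AdviceFreeQNC0.LocalEngine
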